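import Literature.Geometry.Kaehler.CechDeRham

/-!
# Route NikulinTwinTransport — `LefschetzOneOneK3`: the zigzag formula for `ADoubleComplex.rowColEquiv`

Step (a) of the residual input (Z) (`CechCocycleIntegral`, companion files `…Assembly` / `…CechIntegrality`) of the `∂∂̄`–exponential line for the route item `LefschetzOneOneK3`:
"the Čech–de Rham isomorphism of an acyclic cover sends the class of a closed form to the class of
the Čech cocycle of any of its zigzags"). The tree's comparison isomorphism
`Literature.Algebra.Homology.ADoubleComplex.rowColEquiv : Hⁿ(A) ≃ Hⁿ(B)` for a double complex with
exact rows and columns, augmented on both sides, is `totEquiv_A ≫ swapTotEquiv ≫ totEquiv_B⁻¹`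
(both sides are `Hⁿ(Tot)`). This file records the ZIGZAG FORMULA: if the two augmented images of
cocycles `a ∈ Zⁿ⁺¹(A)` and `b ∈ Zⁿ⁺¹(B)` differ in the total complex by a total coboundary,
`ε a (at (0, n+1)) − η b (at (n+1, 0)) = D x` with `x` homogeneous of degree `n`, then
`rowColEquiv [a] = [b]` (Bott–Tu's "collating formula" / tic-tac-toe, Prop. 9.5, in Weibel's
anticommuting conventions). Pure homological algebra on the tree's concrete double complexes.
-/

noncomputable section

open scoped Manifold ContDiff Topology
open Set Function Literature.Algebra.Homology Literature.Algebra.Homology.ADoubleComplex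

namespace Summit.HodgeConjecture.HodgeConjecture.Theorems

section Abstract

universe u w w' w''

variable {R : Type u} [CommRing R] {X : ℕ → ℕ → Type w} [∀ p q, AddCommGroup (X p q)]
  [∀ p q, Module R (X p q)] {K : ADoubleComplex R X}
  {A : ℕ → Type w'} [∀ n, AddCommGroup (A n)] [∀ n, Module R (A n)]
  {B : ℕ → Type w''} [∀ n, AddCommGroup (B n)] [∀ n, Module R (B n)]

/-- Transposition of a single entry. [folklore] -/
theorem swapₗ_single (p q : ℕ) (v : X p q) :
    swapₗ R (single p q v) = single (X := fun p q ↦ X q p) q p v := by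
  funext p' q'
  rw [swapₗ_apply]
  by_cases h : q' = p ∧ p' = q
  · obtain ⟨rfl, rfl⟩ := h
    rw [single_apply_same, single_apply_same]
  · rw [single_apply_of_ne (by tauto), single_apply_of_ne (by tauto)]

/-- **The zigzag (collating) formula for `rowColEquiv`.** For a row- and column-exact double
complex `K` augmented by `A` (rows, `ε`) and `B` (columns, `η`), cocycles `a ∈ Zⁿ⁺¹(A)`,
`b ∈ Zⁿ⁺¹(B)` and a homogeneous total cochain `x` of degree `n` with
`(ε a at (0, n+1)) − (η b at (n+1, 0)) = D x`, the comparison isomorphism identifies the classes: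
`rowColEquiv [a] = [b]`. [cite: BottTu1982Forms, Prop. 9.5] [cite: Weibel1994, Lemma 2.7.3 (proof)] -/
theorem rowColEquiv_mk_eq_mk_of_totalD (E : K.RowAugmentation A) (E' : K.ColAugmentation B)
    (hK : K.RowExact) (hE : E.Exact) (hK' : K.ColExact) (hE' : E'.Exact) {n : ℕ}
    (a : ↥(NatCochain.cocycles E.dA (n + 1))) (b : ↥(NatCochain.cocycles E'.dA (n + 1)))
    (x : ∀ p q, X p q) (hx : x ∈ Tn R n)
    (h : single 0 (n + 1) (E.ε (n + 1) a) - single (n + 1) 0 (E'.ε (n + 1) b) = K.totalD x) :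
    rowColEquiv E E' hK hE hK' hE' (n + 1) (NatCochain.Cohomology.mk E.dA (n + 1) a) =
      NatCochain.Cohomology.mk E'.dA (n + 1) b := by
  rw [rowColEquiv, LinearEquiv.trans_apply, LinearEquiv.trans_apply, LinearEquiv.symm_apply_eq]
  -- both sides in `Hⁿ⁺¹(Tot K.swap)`
  change K.swapTotEquiv (n + 1) (E.totMap (n + 1) (NatCochain.Cohomology.mk E.dA (n + 1) a)) =
    E'.totMap (n + 1) (NatCochain.Cohomology.mk E'.dA (n + 1) b)
  rw [RowAugmentation.totMap_mk, RowAugmentation.totMap_mk, swapTotEquiv,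
    NatCochain.Cohomology.equivOfBijective_apply, NatCochain.Cohomology.map_mk,
    NatCochain.Cohomology.mk_eq_mk_iff, ← mem_coboundaries_totD_iff, totB_succ, Submodule.mem_map]
  refine ⟨swapₗ R x, swapₗ_mem_Tn hx, ?_⟩
  simp only [Submodule.coe_sub, NatCochain.Cohomology.coe_mapCocycles, coe_swapTn,
    RowAugmentation.coe_εTot]
  rw [← K.swapₗ_totalD, ← h, map_sub, swapₗ_single, swapₗ_single]

end Abstract

/-! ### The Čech–de Rham zigzag in degree `2` -/

section CechDeRham

open Literature.Geometry.Kaehler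

variable {E : Type*} [NormedAddCommGroup E] [NormedSpace ℝ E]
  {H : Type*} [TopologicalSpace H] {I : ModelWithCorners ℝ E H}
  {M : Type*} [TopologicalSpace M] [ChartedSpace H M] [IsManifold I ∞ M]
  {F : Type*} [NormedAddCommGroup F] [NormedSpace ℝ F]
  {ι : Type*} {U : ι → Set M} (hU : ∀ i, IsOpen (U i))

/-- **The Čech–de Rham zigzag identity in degree `2`.** For the Čech–de Rham double complex of an
open cover, a closed `2`-form `θ` on `M`, Čech `0`-cochains `α` of `1`-forms with `dα_J = θ` on
`U_J`, Čech `1`-cochains `g` of `0`-forms with `dg_J = (δα)_J` on `U_J`, and closed `0`-forms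
`b_J = −(δg)_J` on the triple intersections: the augmented images of `θ` and `b` differ by the
total coboundary of `x = (α at (0,1)) + (g at (1,0))`. [cite: BottTu1982Forms, Prop. 9.5] -/
theorem cechDeRham_zigzag_two (θ : ↥(smoothFormsOn I F (univ : Set M) 2))
    (α : CechForms I F U 0 1)
    (hα : ∀ (J : Fin 1 → ι), ∀ y ∈ cechSet U J, mextDeriv (α J : MForm I M F 1) y = (θ : MForm I M F 2) y)
    (g : CechForms I F U 1 0)
    (hg : ∀ (J : Fin 2 → ι), ∀ y ∈ cechSet U J,
      mextDeriv (g J : MForm I M F 0) y = (cechδ I F hU 0 1 α J : MForm I M F 1) y)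
    (b : CechClosedZeroForms I F U 2)
    (hb : ∀ (J : Fin 3 → ι), ∀ y ∈ cechSet U J,
      (b J : MForm I M F 0) y = -(cechδ I F hU 1 0 g J : MForm I M F 0) y) :
    single 0 2 ((cechDeRhamRow I F hU).ε 2 θ) - single 2 0 ((cechDeRhamCol I F hU).ε 2 b) =
      (cechDeRham I F hU).totalD (single 0 1 α + single 1 0 g) := by
  set K := cechDeRham I F hU with hK
  funext p q
  by_cases hpq : p + q = 2
  · obtain ⟨rfl, rfl⟩ | ⟨rfl, rfl⟩ | ⟨rfl, rfl⟩ :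
        (p = 0 ∧ q = 2) ∨ (p = 1 ∧ q = 1) ∨ (p = 2 ∧ q = 0) := by omega
    · -- (0,2): `θ|_{U_J} = dα_J`
      rw [Pi.sub_apply, Pi.sub_apply, single_apply_same, single_apply_of_ne (Or.inl (by norm_num)),
        sub_zero, totalD_apply_zero_succ, Pi.add_apply, Pi.add_apply, single_apply_same,
        single_apply_of_ne (Or.inl (by norm_num)), add_zero]
      funext J
      apply Subtype.ext
      change ((θ : MForm I M F 2)).restr (cechSet U J) = ((cechd I F hU 0 1 α J : MForm I M F 2))
      rw [cechd_apply, pow_zero, one_smul, coe_localD]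
      funext y
      by_cases hy : y ∈ cechSet U J
      · rw [MForm.restr_apply_of_mem _ hy, MForm.restr_apply_of_mem _ hy, hα J y hy]
      · rw [MForm.restr_apply_of_notMem _ hy, MForm.restr_apply_of_notMem _ hy]
    · -- (1,1): `δα + (-1) dg = 0`
      rw [Pi.sub_apply, Pi.sub_apply, single_apply_of_ne (Or.inl (by norm_num)),
        single_apply_of_ne (Or.inl (by norm_num)), sub_zero, totalD_apply_succ_succ, Pi.add_apply,
        Pi.add_apply, single_apply_same, single_apply_of_ne (Or.inl (by norm_num)), add_zero,
        Pi.add_apply, Pi.add_apply, single_apply_of_ne (Or.inl (by norm_num)), single_apply_same,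
        (zero_add g)]
      funext J
      apply Subtype.ext
      change (0 : MForm I M F 1) = ((cechδ I F hU 0 1 α J : MForm I M F 1)) +
        ((cechd I F hU 1 0 g J : MForm I M F 1))
      rw [cechd_apply, pow_one, Submodule.coe_smul, coe_localD, neg_one_smul]
      funext y
      by_cases hy : y ∈ cechSet U J
      · rw [Pi.zero_apply, Pi.add_apply, Pi.neg_apply, MForm.restr_apply_of_mem _ hy, hg J y hy,
          add_neg_cancel]
      · rw [Pi.zero_apply, Pi.add_apply, Pi.neg_apply, MForm.restr_apply_of_notMem _ hy, neg_zero,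
          add_zero, (cechδ I F hU 0 1 α J).2.2 y hy]
    · -- (2,0): `-b = δg`
      rw [Pi.sub_apply, Pi.sub_apply, single_apply_of_ne (Or.inl (by norm_num)), single_apply_same,
        zero_sub, totalD_apply_succ_zero, Pi.add_apply, Pi.add_apply,
        single_apply_of_ne (Or.inl (by norm_num)), single_apply_same, zero_add]
      funext J
      apply Subtype.ext
      change -((b J : MForm I M F 0)) = ((cechδ I F hU 1 0 g J : MForm I M F 0))
      funext y
      by_cases hy : y ∈ cechSet U J
      · rw [Pi.neg_apply, hb J y hy, neg_neg]
      · rw [Pi.neg_apply, (b J).2.1.2 y hy, (cechδ I F hU 1 0 g J).2.2 y hy, neg_zero]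
  · -- off the antidiagonal `p + q = 2` everything vanishes
    have hx : single 0 1 α + single 1 0 g ∈ Tn ℝ (X := CechForms I F U) 1 :=
      Submodule.add_mem _ (single_mem_Tn ℝ 0 1 α) (single_mem_Tn ℝ 1 0 g)
    have h0 : K.totalD (single 0 1 α + single 1 0 g) p q = 0 :=
      (K.totD 1 ⟨_, hx⟩).2 p q hpq
    rw [h0, Pi.sub_apply, Pi.sub_apply, single_apply_of_ne (by omega), single_apply_of_ne (by omega),
      sub_zero]

/-- **The Čech–de Rham isomorphism on a zigzag (degree `2`).** With the data of
`cechDeRham_zigzag_two`, the Čech–de Rham isomorphism of a de Rham-acyclic finite cover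
(`cechDeRhamEquiv`) sends the class of the closed `2`-form `θ` to the class of the Čech
`2`-cocycle `b` of closed `0`-forms (Bott–Tu's collating formula).
[cite: BottTu1982Forms, Prop. 9.5 and Thm. 8.9] -/
theorem cechDeRhamEquiv_mk_eq_mk_of_zigzag [FiniteDimensional ℝ E] [T2Space M] [SigmaCompactSpace M]
    [Fintype ι] (hcov : ⋃ i, U i = univ)
    (hgood : ∀ (p q : ℕ) (J : Fin (p + 1) → ι),
      localClosedForms I F (q + 1) (cechSet U J) ≤ localExactForms I F (isOpen_cechSet hU J) (q + 1))
    (θ : ↥(NatCochain.cocycles (fun q ↦ localD I F q (isOpen_univ : IsOpen (univ : Set M))) 2))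
    (α : CechForms I F U 0 1)
    (hα : ∀ (J : Fin 1 → ι), ∀ y ∈ cechSet U J,
      mextDeriv (α J : MForm I M F 1) y = ((θ : smoothFormsOn I F (univ : Set M) 2) : MForm I M F 2) y)
    (g : CechForms I F U 1 0)
    (hg : ∀ (J : Fin 2 → ι), ∀ y ∈ cechSet U J,
      mextDeriv (g J : MForm I M F 0) y = (cechδ I F hU 0 1 α J : MForm I M F 1) y)
    (b : ↥(NatCochain.cocycles (cechClosedδ I F hU) 2))
    (hb : ∀ (J : Fin 3 → ι), ∀ y ∈ cechSet U J,
      ((b : CechClosedZeroForms I F U 2) J : MForm I M F 0) y = -(cechδ I F hU 1 0 g J : MForm I M F 0) y) :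
    cechDeRhamEquiv hU hcov hgood 2 (NatCochain.Cohomology.mk _ 2 θ) =
      NatCochain.Cohomology.mk _ 2 b := by
  unfold cechDeRhamEquiv
  exact rowColEquiv_mk_eq_mk_of_totalD (cechDeRhamRow I F hU) (cechDeRhamCol I F hU) _ _ _ _ θ b
    (single 0 1 α + single 1 0 g)
    (Submodule.add_mem _ (single_mem_Tn ℝ 0 1 α) (single_mem_Tn ℝ 1 0 g))
    (cechDeRham_zigzag_two hU _ α hα g hg _ hb)

end CechDeRham

end Summit.HodgeConjecture.HodgeConjecture.Theorems

end
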